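import Literature.AlgebraicGeometry.HodgeTheory.QuaternionicQuarticGenericModelOfLifting
import Literature.AlgebraicGeometry.Resolution.SurfaceResolutionKollarConclusion
import HarnessLib

/-!
# The generic smooth projective `Q₈`-model from the Cossart–Jannsen–Saito canonical resolution of surfaces (brick M1-4a re-keyed)

Layer `Literature/AlgebraicGeometry/HodgeTheory`. One theorem (no definition, no new named fact). Route
`HodgeConjecture/Q8SymplecticPowers` (crux K1Q, stmt-HodgeConjecture-24190): brick M1-4a `Q8Family.exists_genericModel` was
conditional on Kollár's all-dimension functorial-resolution fact; `exists_genericModel_of_surfaceLifting` re-keyed it on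
equivariant resolution of `Q₈`-SURFACES over `K = Frac ℂ[a]`, and
`Resolution.CossartJannsenSaito2020SequenceFunctorial.exists_actionOver_of_dim_le_two` supplies exactly that from the tree's named
fact `CossartJannsenSaito2020SequenceFunctorial` (CJS 2020 Thm. 1.2: canonical resolution of excellent surfaces, functorial for
Zariski localisations — hence for automorphisms). So:

* `exists_genericModel_of_CJS` — GIVEN the CJS fact, the generic smooth projective `Q₈`-model exists (conclusion of
  `exists_genericModel`).

Honest scope: conditional on ONE named fact about surfaces (CJS Thm. 1.2) instead of Kollár Thm. 3.36 (all dimensions); nothing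
here bears on HC.

## References

* [CossartJannsenSaito2020] V. Cossart, U. Jannsen, S. Saito, Desingularization: invariants and strategy (LNM 2270, 2020), Thm. 1.2.
* [Kollar2007] J. Kollár, Lectures on Resolution of Singularities (2007), Thm. 3.36, §3.4.1.
* [DeJong1996] A. J. de Jong, Smoothness, semi-stability and alterations (1996), 4.17.
-/

noncomputable section

open CategoryTheory CategoryTheory.Limits AlgebraicGeometry TopologicalSpace

namespace Literature.AlgebraicGeometry.HodgeTheory.Q8Family

open Literature.AlgebraicGeometry.Motives Literature.AlgebraicGeometry.RelativeSpec
  Literature.AlgebraicGeometry.Resolution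

/-- **The generic smooth projective `Q₈`-model, GIVEN the Cossart–Jannsen–Saito canonical resolution of surfaces.**
For `e ≥ 2` there is a smooth projective geometrically irreducible surface `E` over `K = Frac ℂ[a]` with a `Q₈`-action and a
`Q₈`-equivariant open immersion `genericChart e K ↪ E` over `K`. [cite: CossartJannsenSaito2020, Thm. 1.2 (p. 5)]
[cite: Kollar2007, Thm. 3.36 and §3.4.1 (p. 121)] [cite: DeJong1996, 4.17, p. 72] -/
theorem exists_genericModel_of_CJS (hCJS : CossartJannsenSaito2020SequenceFunctorial.{0}) (e : ℕ) (he : 2 ≤ e) :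
    ∃ (E : SchemeOver (FractionRing (ParamRing e))) (ρE : ActionOver E.hom (QuaternionGroup 2))
      (θ : genericChart e (FractionRing (ParamRing e)) ⟶ E),
      IsSmoothProjective 2 E ∧ IsOpenImmersion θ.left ∧
      ∀ g : QuaternionGroup 2,
        ((genericAction e (FractionRing (ParamRing e))).aut g).hom ≫ θ.left = θ.left ≫ (ρE.aut g).hom := by
  refine exists_genericModel_of_surfaceLifting e he fun N _ hN h2 ρN => ?_
  have hd : topologicalKrullDim N.left ≤ 2 := by
    rw [h2]
    exact_mod_cast (le_refl 2)
  exact hCJS.exists_actionOver_of_dim_le_two N hN hd ρN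

end Literature.AlgebraicGeometry.HodgeTheory.Q8Family

end
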